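import Mathlib
import Summits.MatrixMultiplication.MatrixMultiplication.Theorems.SoloBlindFlatModel
import Summits.MatrixMultiplication.MatrixMultiplication.Theorems.SoloBlindFlatCorankOne
import Summits.MatrixMultiplication.MatrixMultiplication.Theorems.SoloBlindEFlatCorankOne

/-!
# The K♭ / E♭ checker is sound for configurations

Assembly of `SoloBlindFlatCheckSound` (pattern-model soundness of the executable checker
`soloBlindFlatFamCheck`), `SoloBlindFlatModel` (the configuration realises the pattern model),
`SoloBlindFlatMultiplicity` (vertex reduction) and the rank lemma: in the type-model setting
(linearly independent, subset-sum-distinct block `B`; letters `x : Fin m ↪ ι` avoiding `B`; `h`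
zero-sum free on `B ∪ X`), if the exact family of `τ` uses every letter and has at least two members,
the core of `τ` meets the block, and the checker accepts the family at a scale `S ≥ m + 1`, then
`K(τ; B ∪ X) ≤ 1 + 2^{-ρ} - 2^{ρ-c}` (mode K), and `≤ 1/2 + 2^{-ρ} - 2^{ρ-1-c}` for `H`-good `τ`
(mode E), where `ρ` is the core rank and `c` the core size (`soloBlind_flatSound_K`, `soloBlind_flatSound_E`).
-/

namespace Summit.MatrixMultiplication.MatrixMultiplication.Theorems

open Finset Module

/-- The scaled threshold of mode K plus the `E`-term, in closed form. -/
theorem soloBlind_flatR_K {S d e : ℕ} (hd : d ≤ S) :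
    (((2 ^ S : ℕ) : ℚ) - ((2 ^ (S - d) : ℕ) : ℚ)) / 2 ^ S + (1 / 2 : ℚ) ^ e =
      1 + (1 / 2 : ℚ) ^ e - (1 / 2 : ℚ) ^ d := by
  have e1 : (2 : ℚ) ^ S = 2 ^ (S - d) * 2 ^ d := by rw [← pow_add, Nat.sub_add_cancel hd]
  push_cast
  rw [e1, one_div_pow, one_div_pow]
  field_simp
  ring

/-- The scaled threshold of mode E plus the `E`-term, in closed form. -/
theorem soloBlind_flatR_E {S d e : ℕ} (hd : d + 1 ≤ S) :
    (((2 ^ (S - 1) : ℕ) : ℚ) - ((2 ^ (S - d - 1) : ℕ) : ℚ)) / 2 ^ S + (1 / 2 : ℚ) ^ e =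
      1 / 2 + (1 / 2 : ℚ) ^ e - (1 / 2 : ℚ) ^ (d + 1) := by
  have e1 : (2 : ℚ) ^ S = 2 ^ (S - d - 1) * 2 ^ (d + 1) := by
    rw [← pow_add]; congr 1; omega
  have e2 : (2 : ℚ) ^ (S - 1) = 2 ^ (S - d - 1) * 2 ^ d := by
    rw [← pow_add]; congr 1; omega
  push_cast
  rw [e1, e2, one_div_pow, one_div_pow]
  field_simp
  ring

variable {G : Type*} [AddCommGroup G] [DecidableEq G] [Module (ZMod 3) G] {ι : Type*} [DecidableEq ι]

/-- A list with at least two entries contains its head. -/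
private theorem soloBlind_headD_mem {F : List ℕ} (h2 : 2 ≤ F.length) : F.headD 0 ∈ F := by
  match F, h2 with
  | M :: _, _ => exact List.mem_cons_self

/-- SOUNDNESS OF THE CHECKER FOR A CONFIGURATION (both modes): the mass is at most the mode's
threshold plus the `E`-term `2^{-(m - d + |core ∩ B|)}`, and `coreRank + d ≤ |core ∩ B| + m`,
`|core| = |core ∩ B| + m`, `d ≤ m`. -/
theorem soloBlind_flatSound {h : ι → G} {B : Finset ι}
    (hli : LinearIndependent (ZMod 3) (fun i : B => h i))
    (hdist : ∀ A ⊆ B, ∀ A' ⊆ B, ∑ i ∈ A, h i = ∑ i ∈ A', h i → A = A')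
    {m : ℕ} (x : Fin m ↪ ι) (hxB : ∀ a, x a ∉ B) (τ : G) (modeE : Bool)
    (zsf : ∀ T ⊆ B ∪ Finset.univ.map x, T.Nonempty → ∑ i ∈ T, h i ≠ 0)
    (hgood : modeE = true → ∀ T ⊆ B ∪ Finset.univ.map x, ∑ i ∈ T, h i ≠ τ + τ) (S : ℕ)
    (hadm : soloBlindFlatAdmissible m (soloBlindExactFam h B x τ) = true)
    (hcheck : soloBlindFlatFamCheck (soloBlindMkFlatTabs m) m S (soloBlindExactFam h B x τ) modeE = true)
    (hu : (soloBlindCore h (B ∪ Finset.univ.map x) τ ∩ B).Nonempty) :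
    soloBlindMass h (B ∪ Finset.univ.map x) τ ≤
        (((if modeE then 2 ^ (S - 1) else 2 ^ S : ℕ) : ℚ) -
            ((if modeE then 2 ^ (S - soloBlindFlatD (soloBlindMkFlatTabs m) m (soloBlindExactFam h B x τ)
                ((soloBlindExactFam h B x τ).headD 0) - 1)
              else 2 ^ (S - soloBlindFlatD (soloBlindMkFlatTabs m) m (soloBlindExactFam h B x τ)
                ((soloBlindExactFam h B x τ).headD 0)) : ℕ) : ℚ)) / 2 ^ S +
          (1 / 2 : ℚ) ^ (m - soloBlindFlatD (soloBlindMkFlatTabs m) m (soloBlindExactFam h B x τ)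
              ((soloBlindExactFam h B x τ).headD 0) +
            (soloBlindCore h (B ∪ Finset.univ.map x) τ ∩ B).card) ∧
      soloBlindCoreRank h (B ∪ Finset.univ.map x) τ +
          soloBlindFlatD (soloBlindMkFlatTabs m) m (soloBlindExactFam h B x τ)
            ((soloBlindExactFam h B x τ).headD 0) ≤
        (soloBlindCore h (B ∪ Finset.univ.map x) τ ∩ B).card + m ∧
      (soloBlindCore h (B ∪ Finset.univ.map x) τ).card =
        (soloBlindCore h (B ∪ Finset.univ.map x) τ ∩ B).card + m ∧
      soloBlindFlatD (soloBlindMkFlatTabs m) m (soloBlindExactFam h B x τ)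
        ((soloBlindExactFam h B x τ).headD 0) ≤ m := by
  -- admissibility: at least two members, every letter used
  unfold soloBlindFlatAdmissible at hadm
  rw [Bool.and_eq_true, decide_eq_true_eq, List.all_eq_true] at hadm
  obtain ⟨h2, hall⟩ := hadm
  have hused : ∀ a : Fin m, ∃ M ∈ soloBlindExactFam h B x τ, M.testBit a = true := fun a => by
    have ha := hall a (List.mem_range.mpr a.2)
    rw [List.any_eq_true] at ha
    exact ha
  have hC₀ : (soloBlindExactFam h B x τ).headD 0 ∈ soloBlindExactFam h B x τ := soloBlind_headD_mem h2
  have hC₀2 := soloBlind_exactFam_lt hC₀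
  -- the active pattern indices
  have hJsub : ∀ j ∈ soloBlindJAct hli x τ,
      j < (soloBlindPats (soloBlindMkFlatTabs m) m (soloBlindExactFam h B x τ)).length :=
    fun j hj => soloBlind_jAct_lt hli x τ hj
  have hJne : (soloBlindJAct hli x τ).Nonempty := by
    obtain ⟨y, hy⟩ := hu
    rw [Finset.mem_inter] at hy
    have hv := (soloBlind_visB_iff_mem_core hli x τ hxB ⟨y, hy.2⟩).mpr hy.1
    obtain ⟨j, hj, -⟩ := soloBlind_exists_fib hli x τ hv
    exact ⟨j, hj⟩
  have hvalid : soloBlindValidSem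
      (soloBlindFlatInstOf (soloBlindMkFlatTabs m) m S (soloBlindExactFam h B x τ) modeE).kms
      (soloBlindJAct hli x τ) :=
    soloBlind_validSem_jAct hli x τ hxB modeE zsf hgood hC₀
  -- pattern-model soundness of the checker, then the multiplicity induction
  obtain ⟨hV0, hV1⟩ := soloBlind_flatFamCheck_sound (soloBlindMkFlatTabs m) m S
    (soloBlindExactFam h B x τ) modeE hcheck (soloBlindJAct hli x τ) hJne hJsub hvalid
  have hmult : soloBlindPatMass
      (Finset.range ((soloBlindExactFam h B x τ).map fun M => (soloBlindDecSet m M).card).length)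
      (soloBlindSzL ((soloBlindExactFam h B x τ).map fun M => (soloBlindDecSet m M).card))
      (soloBlindJAct hli x τ)
      (soloBlindSeesL (soloBlindPats (soloBlindMkFlatTabs m) m (soloBlindExactFam h B x τ)))
      (soloBlindPatMult hli x τ) -
      (1 / 2 : ℚ) ^ (m - soloBlindFlatD (soloBlindMkFlatTabs m) m (soloBlindExactFam h B x τ)
          ((soloBlindExactFam h B x τ).headD 0) + ∑ j ∈ soloBlindJAct hli x τ, soloBlindPatMult hli x τ j) ≤
      (((if modeE then 2 ^ (S - 1) else 2 ^ S : ℕ) : ℚ) -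
          ((if modeE then 2 ^ (S - soloBlindFlatD (soloBlindMkFlatTabs m) m (soloBlindExactFam h B x τ)
              ((soloBlindExactFam h B x τ).headD 0) - 1)
            else 2 ^ (S - soloBlindFlatD (soloBlindMkFlatTabs m) m (soloBlindExactFam h B x τ)
              ((soloBlindExactFam h B x τ).headD 0)) : ℕ) : ℚ)) / 2 ^ S :=
    soloBlind_multiplicity_induction _ _ _ _ _ _ hV0 hV1 (soloBlindPatMult hli x τ)
      (fun j hj => by
        unfold soloBlindJAct at hj
        exact (Finset.mem_filter.mp hj).2)
  rw [soloBlind_sum_mult hli x τ, soloBlind_card_visB hli x τ hxB] at hmult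
  have hmass := soloBlind_mass_le_patMass hli x τ hxB hdist
  have hrank := soloBlind_coreRank_add_flatD_le x τ hxB hC₀
  have hcard := soloBlind_card_core_of_used x τ hxB hused
  have hdm : soloBlindFlatD (soloBlindMkFlatTabs m) m (soloBlindExactFam h B x τ)
      ((soloBlindExactFam h B x τ).headD 0) ≤ m :=
    soloBlind_flatD_le hC₀2 fun M hM => soloBlind_exactFam_lt hM
  exact ⟨by linarith, hrank, hcard, hdm⟩

/-- CONJECTURE K♭ FOR A CHECKED CONFIGURATION (mode K). -/
theorem soloBlind_flatSound_K {h : ι → G} {B : Finset ι}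
    (hli : LinearIndependent (ZMod 3) (fun i : B => h i))
    (hdist : ∀ A ⊆ B, ∀ A' ⊆ B, ∑ i ∈ A, h i = ∑ i ∈ A', h i → A = A')
    {m : ℕ} (x : Fin m ↪ ι) (hxB : ∀ a, x a ∉ B) (τ : G)
    (zsf : ∀ T ⊆ B ∪ Finset.univ.map x, T.Nonempty → ∑ i ∈ T, h i ≠ 0) {S : ℕ} (hS : m ≤ S)
    (hadm : soloBlindFlatAdmissible m (soloBlindExactFam h B x τ) = true)
    (hcheck : soloBlindFlatFamCheck (soloBlindMkFlatTabs m) m S (soloBlindExactFam h B x τ) false = true)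
    (hu : (soloBlindCore h (B ∪ Finset.univ.map x) τ ∩ B).Nonempty) :
    soloBlindKFlatAt h (B ∪ Finset.univ.map x) τ := by
  obtain ⟨hmass, hrank, hcard, hdm⟩ :=
    soloBlind_flatSound hli hdist x hxB τ false zsf (fun hf => Bool.noConfusion hf) S hadm hcheck hu
  simp only [Bool.false_eq_true, if_false] at hmass
  rw [soloBlind_flatR_K (by omega)] at hmass
  have hb1 : 1 + (1 / 2 : ℚ) ^ (m - soloBlindFlatD (soloBlindMkFlatTabs m) m (soloBlindExactFam h B x τ)
        ((soloBlindExactFam h B x τ).headD 0) + (soloBlindCore h (B ∪ Finset.univ.map x) τ ∩ B).card) -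
      (1 / 2 : ℚ) ^ (soloBlindFlatD (soloBlindMkFlatTabs m) m (soloBlindExactFam h B x τ)
        ((soloBlindExactFam h B x τ).headD 0)) =
      soloBlindFlatBound ((soloBlindCore h (B ∪ Finset.univ.map x) τ ∩ B).card + m -
        soloBlindFlatD (soloBlindMkFlatTabs m) m (soloBlindExactFam h B x τ) ((soloBlindExactFam h B x τ).headD 0))
        ((soloBlindCore h (B ∪ Finset.univ.map x) τ ∩ B).card + m) := by
    unfold soloBlindFlatBound
    rw [show (soloBlindCore h (B ∪ Finset.univ.map x) τ ∩ B).card + m -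
        ((soloBlindCore h (B ∪ Finset.univ.map x) τ ∩ B).card + m -
          soloBlindFlatD (soloBlindMkFlatTabs m) m (soloBlindExactFam h B x τ) ((soloBlindExactFam h B x τ).headD 0)) =
        soloBlindFlatD (soloBlindMkFlatTabs m) m (soloBlindExactFam h B x τ) ((soloBlindExactFam h B x τ).headD 0)
        by omega,
      show m - soloBlindFlatD (soloBlindMkFlatTabs m) m (soloBlindExactFam h B x τ)
          ((soloBlindExactFam h B x τ).headD 0) + (soloBlindCore h (B ∪ Finset.univ.map x) τ ∩ B).card =
        (soloBlindCore h (B ∪ Finset.univ.map x) τ ∩ B).card + m -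
          soloBlindFlatD (soloBlindMkFlatTabs m) m (soloBlindExactFam h B x τ) ((soloBlindExactFam h B x τ).headD 0)
        by omega]
  have hb2 : soloBlindFlatBound ((soloBlindCore h (B ∪ Finset.univ.map x) τ ∩ B).card + m -
        soloBlindFlatD (soloBlindMkFlatTabs m) m (soloBlindExactFam h B x τ) ((soloBlindExactFam h B x τ).headD 0))
        ((soloBlindCore h (B ∪ Finset.univ.map x) τ ∩ B).card + m) ≤
      soloBlindFlatBound (soloBlindCoreRank h (B ∪ Finset.univ.map x) τ)
        ((soloBlindCore h (B ∪ Finset.univ.map x) τ ∩ B).card + m) :=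
    soloBlind_flatBound_anti (by omega) (by omega)
  unfold soloBlindKFlatAt
  rw [hcard]
  exact (hmass.trans hb1.le).trans hb2

/-- CONJECTURE E♭ FOR A CHECKED CONFIGURATION (mode E, `H`-good `τ`). -/
theorem soloBlind_flatSound_E {h : ι → G} {B : Finset ι}
    (hli : LinearIndependent (ZMod 3) (fun i : B => h i))
    (hdist : ∀ A ⊆ B, ∀ A' ⊆ B, ∑ i ∈ A, h i = ∑ i ∈ A', h i → A = A')
    {m : ℕ} (x : Fin m ↪ ι) (hxB : ∀ a, x a ∉ B) (τ : G)
    (zsf : ∀ T ⊆ B ∪ Finset.univ.map x, T.Nonempty → ∑ i ∈ T, h i ≠ 0)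
    (hgood : ∀ T ⊆ B ∪ Finset.univ.map x, ∑ i ∈ T, h i ≠ τ + τ) {S : ℕ} (hS : m + 1 ≤ S)
    (hadm : soloBlindFlatAdmissible m (soloBlindExactFam h B x τ) = true)
    (hcheck : soloBlindFlatFamCheck (soloBlindMkFlatTabs m) m S (soloBlindExactFam h B x τ) true = true)
    (hu : (soloBlindCore h (B ∪ Finset.univ.map x) τ ∩ B).Nonempty) :
    soloBlindEFlatAt h (B ∪ Finset.univ.map x) τ := by
  obtain ⟨hmass, hrank, hcard, hdm⟩ :=
    soloBlind_flatSound hli hdist x hxB τ true zsf (fun _ => hgood) S hadm hcheck hu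
  simp only [if_true] at hmass
  rw [soloBlind_flatR_E (by omega)] at hmass
  have hb1 : 1 / 2 + (1 / 2 : ℚ) ^ (m - soloBlindFlatD (soloBlindMkFlatTabs m) m (soloBlindExactFam h B x τ)
        ((soloBlindExactFam h B x τ).headD 0) + (soloBlindCore h (B ∪ Finset.univ.map x) τ ∩ B).card) -
      (1 / 2 : ℚ) ^ (soloBlindFlatD (soloBlindMkFlatTabs m) m (soloBlindExactFam h B x τ)
        ((soloBlindExactFam h B x τ).headD 0) + 1) =
      soloBlindEFlatBound ((soloBlindCore h (B ∪ Finset.univ.map x) τ ∩ B).card + m -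
        soloBlindFlatD (soloBlindMkFlatTabs m) m (soloBlindExactFam h B x τ) ((soloBlindExactFam h B x τ).headD 0))
        ((soloBlindCore h (B ∪ Finset.univ.map x) τ ∩ B).card + m) := by
    unfold soloBlindEFlatBound
    rw [show (soloBlindCore h (B ∪ Finset.univ.map x) τ ∩ B).card + m + 1 -
        ((soloBlindCore h (B ∪ Finset.univ.map x) τ ∩ B).card + m -
          soloBlindFlatD (soloBlindMkFlatTabs m) m (soloBlindExactFam h B x τ) ((soloBlindExactFam h B x τ).headD 0)) =
        soloBlindFlatD (soloBlindMkFlatTabs m) m (soloBlindExactFam h B x τ) ((soloBlindExactFam h B x τ).headD 0) + 1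
        by omega,
      show m - soloBlindFlatD (soloBlindMkFlatTabs m) m (soloBlindExactFam h B x τ)
          ((soloBlindExactFam h B x τ).headD 0) + (soloBlindCore h (B ∪ Finset.univ.map x) τ ∩ B).card =
        (soloBlindCore h (B ∪ Finset.univ.map x) τ ∩ B).card + m -
          soloBlindFlatD (soloBlindMkFlatTabs m) m (soloBlindExactFam h B x τ) ((soloBlindExactFam h B x τ).headD 0)
        by omega]
  have hb2 : soloBlindEFlatBound ((soloBlindCore h (B ∪ Finset.univ.map x) τ ∩ B).card + m -
        soloBlindFlatD (soloBlindMkFlatTabs m) m (soloBlindExactFam h B x τ) ((soloBlindExactFam h B x τ).headD 0))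
        ((soloBlindCore h (B ∪ Finset.univ.map x) τ ∩ B).card + m) ≤
      soloBlindEFlatBound (soloBlindCoreRank h (B ∪ Finset.univ.map x) τ)
        ((soloBlindCore h (B ∪ Finset.univ.map x) τ ∩ B).card + m) :=
    soloBlind_eflatBound_anti (by omega) (by omega)
  unfold soloBlindEFlatAt
  rw [hcard]
  exact (hmass.trans hb1.le).trans hb2

end Summit.MatrixMultiplication.MatrixMultiplication.Theorems
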